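import Summits.CriticalPhenomena.SAWScalingLimit.Theorems.BoundaryClosureR.Negative.PeelEnd

/-!
# Negative knowledge on crux `BoundaryClosureR` (stmt-CriticalPhenomena-14004), part 3/5: the corridor
seen from the normalisation side

Root `bEdge` (inside the rigid half-lattice ball at `0`), normaliser at the junction edge `aEdge X`
(body, `wc = false`) or at the corridor tip `aEdge T` (body ∪ corridor, `wc = true`) of the corridor
family `BoundaryClosure.Negative.Lam δ wc` on the half-disc.  Growing the corridor one face at a time
(`LamM`): the observable from `bEdge` is UNCHANGED at every mid-edge avoiding the corridor faces while at
the successive tips it picks up one factor `x e^{-iσθ}` per face (`observable_LamM_end`,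
`observable_corridor_end`); hence the normalised functionals `NR wc ψ δ` (root `bEdge`, normaliser
`aEdge (rootCell δ wc)`) satisfy `NR false = κ · NR true`, `‖κ‖ = x_c^{corrLen δ}`, `corrLen = 2T - 2X`
(`NR_false_eq`), and `x_c^{corrLen δ} → 0` as `δ → 0⁺` (`le_corrLen`, `tendsto_pow_corrLen`).
Everything proved. [folklore]
-/

noncomputable section

open Set Filter Topology Complex
open Literature.Probability.RandomPlanarGeometry
open UpperHalfPlane (upperHalfPlaneSet)
open Literature.Probability.LatticeModels Literature.Probability.RandomPlanarGeometry.SAW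

namespace Summit.CriticalPhenomena.SAWScalingLimit.Theorems.BoundaryClosureR.Negative

open BoundaryClosure.Negative

/-! ## Part C — the corridor seen from the normalisation side

Root `bEdge` (inside the rigid half-lattice ball at `0`), normaliser at the junction edge `aEdge X`
(body, `wc = false`) or at the corridor tip `aEdge T` (body ∪ corridor, `wc = true`). Growing the
corridor one face at a time from the body: the observable from `bEdge` is UNCHANGED at every mid-edge
avoiding the corridor faces (dead ends are invisible), while at the successive tips it picks up one
factor `x e^{-iσθ}` per face. -/

section CorridorEnd

variable {δ : ℝ} (hδ : 0 < δ) (hδ' : δ ≤ 1 / 16)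
include hδ hδ'

/-- The (pinned) root edge `bEdge` is a mid-edge of every `LamM m`. [folklore] -/
theorem bEdge_mem_midEdges_LamM (m : ℤ) : bEdge ∈ hexDomainMidEdges (LamM δ m) := by
  refine ⟨(SimpleGraph.mem_edgeSet hexGraph).2 ?_, fj 0 0, Sym2.mem_mk_left _ _, ?_⟩
  · simpa using adj_fj_down (show (0:ℤ) % 2 = 0 by norm_num) 0
  · unfold LamM
    rw [Finset.mem_union]
    left
    have hX := Xc_pos hδ (δ := δ)
    exact fj_row_zero_mem hδ hδ' false le_rfl (by unfold rootCell; simp; omega)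

omit hδ hδ' in
/-- Corridor faces are not on the root edge `bEdge`. [folklore] -/
theorem fj_not_mem_bEdge {i : ℤ} (hi : 2 ≤ i) : fj i 0 ∉ bEdge := by
  unfold bEdge
  intro h
  rcases Sym2.mem_iff.1 h with h | h
  · have := (fj_inj.1 h).1; omega
  · have := (fj_inj.1 h).2; omega

omit hδ hδ' in
/-- The norm of the peeling factor `x e^{-iσθ}` is `|x|`. [folklore] -/
theorem norm_peel_factor (x σ θ : ℝ) :
    ‖(x : ℂ) * Complex.exp (-Complex.I * σ * (θ : ℝ))‖ = |x| := by
  rw [norm_mul, Complex.norm_real, Real.norm_eq_abs, Complex.norm_exp]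
  simp

/-- **The corridor from the normalisation side**: the observable of `LamM (2X+1+n)` from `bEdge`
equals that of the body at every mid-edge avoiding the corridor faces, and at the tip `rootM (2X+1+n)`
it is `κ_n` times the body's value at the junction edge `aEdge X`, `‖κ_n‖ = |x|^n`. [folklore] -/
theorem observable_LamM_end (x σ : ℝ) (n : ℕ) (hn : 2 * Xc δ + 1 + n ≤ 2 * Tc δ + 1) :
    (∀ z : Sym2 HexVertex, (∀ i : ℤ, 2 * Xc δ + 2 ≤ i → i ≤ 2 * Xc δ + 1 + n → fj i 0 ∉ z) →
      hexParafermionicObservable (LamM δ (2 * Xc δ + 1 + n)) bEdge x σ z =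
        hexParafermionicObservable (Lam δ false) bEdge x σ z) ∧
    ∃ κ : ℂ, ‖κ‖ = |x| ^ n ∧
      hexParafermionicObservable (LamM δ (2 * Xc δ + 1 + n)) bEdge x σ (rootM (2 * Xc δ + 1 + n)) =
        κ * hexParafermionicObservable (Lam δ false) bEdge x σ (aEdge (Xc δ)) := by
  induction n with
  | zero =>
    simp only [Nat.cast_zero, add_zero, pow_zero]
    rw [LamM_base, rootM_odd]
    exact ⟨fun z _ => rfl, 1, norm_one, (one_mul _).symm⟩
  | succ n ih =>
    obtain ⟨ih1, κ, hκ, ih2⟩ := ih (by push_cast at hn; omega)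
    set m : ℤ := 2 * Xc δ + 1 + n with hm
    have hX := Xc_pos hδ (δ := δ)
    obtain ⟨P1, P2, P3, P4, P5, P6, P7⟩ := peel_hyps_LamM hδ hδ' (m := m) (by omega)
    have e1 : (2 * Xc δ + 1 + ((n + 1 : ℕ) : ℤ)) = m + 1 := by push_cast; ring
    have hu : fj (m + 2) 0 ∉ insert (fj (m + 1) 0) (LamM δ m) := by
      rw [Finset.mem_insert, not_or]; exact ⟨P3, P2⟩
    have hta : fj (m + 1) 0 ∉ bEdge := fj_not_mem_bEdge (by omega)
    have haΛ := bEdge_mem_midEdges_LamM hδ hδ' m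
    rw [e1, LamM_succ hδ hδ' (by omega)]
    refine ⟨fun z hz => ?_, ?_⟩
    · -- invisibility of the new dead end, then the induction hypothesis
      have htz : fj (m + 1) 0 ∉ z := hz (m + 1) (by omega) (by omega)
      rw [observable_insert_of_deadEnd P7 hta htz haΛ]
      exact ih1 z fun i hi hi' => hz i hi (by omega)
    · -- the tip picks up one peeling factor
      refine ⟨((x : ℂ) * Complex.exp (-Complex.I * σ * (turning (hexCenter (fj m 0)) (hexCenter (fj (m + 1) 0))
        (hexMidpoint s(fj (m + 2) 0, fj (m + 1) 0)) : ℝ))) * κ, ?_, ?_⟩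
      · rw [norm_mul, norm_peel_factor, hκ, pow_succ]; ring
      · rw [show rootM (m + 1) = s(fj (m + 2) 0, fj (m + 1) 0) by
            unfold rootM; rw [show m + 1 + 1 = m + 2 by ring],
          observable_insert_tip P1 P6 P5.symm hu P4.symm P7 hta haΛ x σ]
        have key : hexParafermionicObservable (LamM δ m) bEdge x σ s(fj m 0, fj (m + 1) 0) =
            κ * hexParafermionicObservable (Lam δ false) bEdge x σ (aEdge (Xc δ)) := by
          rw [← ih2, rootM, Sym2.eq_swap]
        rw [key]; ring

omit hδ hδ' in
/-- The number of corridor faces, `2T - 2X`. [folklore] -/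
def corrLen (δ : ℝ) : ℕ := (2 * Tc δ - 2 * Xc δ).toNat

/-- **The corridor from the normalisation side, final form**: from the pinned root `bEdge` the
observables of body ∪ corridor and of the body coincide at every mid-edge avoiding the corridor faces,
and at the tip `aEdge T` versus the junction `aEdge X` they differ by a factor of norm `|x|^{2T-2X}`.
[folklore] -/
theorem observable_corridor_end (x σ : ℝ) :
    (∀ z : Sym2 HexVertex, (∀ i : ℤ, 2 * Xc δ + 2 ≤ i → fj i 0 ∉ z) →
      hexParafermionicObservable (Lam δ true) bEdge x σ z =
        hexParafermionicObservable (Lam δ false) bEdge x σ z) ∧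
    ∃ κ : ℂ, ‖κ‖ = |x| ^ corrLen δ ∧
      hexParafermionicObservable (Lam δ true) bEdge x σ (aEdge (Tc δ)) =
        κ * hexParafermionicObservable (Lam δ false) bEdge x σ (aEdge (Xc δ)) := by
  have hXT := Xc_add_two_le_Tc hδ hδ'
  have hn : ((corrLen δ : ℕ) : ℤ) = 2 * Tc δ - 2 * Xc δ := by unfold corrLen; omega
  obtain ⟨h1, κ, hκ, h2⟩ := observable_LamM_end hδ hδ' x σ (corrLen δ) (by omega)
  have e : 2 * Xc δ + 1 + (corrLen δ : ℤ) = 2 * Tc δ + 1 := by omega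
  rw [e, LamM_top hδ hδ', rootM_odd] at h2
  refine ⟨fun z hz => ?_, κ, hκ, h2⟩
  have := h1 z fun i hi _ => hz i hi
  rwa [e, LamM_top hδ hδ'] at this

omit hδ hδ' in
/-- The normalised functional of configuration `wc` ROOTED at `bEdge` and NORMALISED at the junction /
tip edge `aEdge (rootCell δ wc)`: `δ² Σ_z ψ(δ·mid z) F(z) / F(aEdge)`. [folklore] -/
def NR (wc : Bool) (ψ : ℂ → ℂ) (δ : ℝ) : ℂ :=
  (δ : ℂ) ^ 2 * (∑ᶠ e ∈ hexDomainMidEdges (Lam δ wc), ψ ((δ : ℂ) * hexMidpoint e) *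
      hexParafermionicObservable (Lam δ wc) bEdge hexCriticalFugacity (5 / 8) e) /
    hexParafermionicObservable (Lam δ wc) bEdge hexCriticalFugacity (5 / 8) (aEdge (rootCell δ wc))

/-- **The two normalised functionals differ by the corridor factor**: `N_body = κ N_{body∪corridor}`
with `‖κ‖ = x_c^{2T-2X}`, whenever the rescaled test function vanishes at the mid-edges of height `< 2`.
[folklore] -/
theorem NR_false_eq (ψ : ℂ → ℂ)
    (hψ : ∀ e : Sym2 HexVertex, ψ ((δ : ℂ) * hexMidpoint e) ≠ 0 → 2 ≤ (hexMidpoint e).im) :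
    ∃ κ : ℂ, ‖κ‖ = hexCriticalFugacity ^ corrLen δ ∧ NR false ψ δ = κ * NR true ψ δ := by
  obtain ⟨hrel, κ, hκ, hb⟩ := observable_corridor_end hδ hδ' hexCriticalFugacity (5 / 8)
  have hx := hexCriticalFugacity_pos_lt_one
  have hκ0 : κ ≠ 0 := by
    rw [← norm_pos_iff, hκ]; exact pow_pos (abs_pos.2 hx.1.ne') _
  refine ⟨κ, by rw [hκ, abs_of_pos hx.1], ?_⟩
  -- the sums agree termwise
  have hS : (∑ᶠ e ∈ hexDomainMidEdges (Lam δ true), ψ ((δ : ℂ) * hexMidpoint e) *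
        hexParafermionicObservable (Lam δ true) bEdge hexCriticalFugacity (5 / 8) e) =
      ∑ᶠ e ∈ hexDomainMidEdges (Lam δ false), ψ ((δ : ℂ) * hexMidpoint e) *
        hexParafermionicObservable (Lam δ false) bEdge hexCriticalFugacity (5 / 8) e := by
    classical
    rw [finsum_mem_def, finsum_mem_def]
    refine finsum_congr fun e => ?_
    by_cases hψe : ψ ((δ : ℂ) * hexMidpoint e) = 0
    · simp only [Set.indicator_apply, hψe, zero_mul, ite_self]
    · have him := hψ e hψe
      by_cases h₁ : e ∈ hexDomainMidEdges (Lam δ false)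
      · have h₂ : e ∈ hexDomainMidEdges (Lam δ true) := by
          obtain ⟨he, v, hv, hvΛ⟩ := h₁
          exact ⟨he, v, hv, Lam_false_subset_true hδ hδ' hvΛ⟩
        rw [Set.indicator_of_mem h₂, Set.indicator_of_mem h₁,
          hrel e fun i _ => fj_row_zero_not_mem_of_im h₁.1 him i]
      · have h₂ : e ∉ hexDomainMidEdges (Lam δ true) := by
          rintro ⟨he, v, hv, hvΛ⟩
          by_cases hv₁ : v ∈ Lam δ false
          · exact h₁ ⟨he, v, hv, hv₁⟩
          · obtain ⟨i, -, rfl⟩ := exists_eq_fj_of_mem_sdiff hδ hδ' hvΛ hv₁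
            exact fj_row_zero_not_mem_of_im he him i hv
        rw [Set.indicator_of_notMem h₂, Set.indicator_of_notMem h₁]
  unfold NR
  simp only [rootCell, Bool.false_eq_true, ↓reduceIte]
  rw [hS, hb, ← mul_div_assoc, ← mul_div_mul_left _ _ hκ0]

omit hδ' in
/-- The corridor is long: `2T - 2X ≥ 1/(2δ) - 4`. [folklore] -/
theorem le_corrLen : 1 / (2 * δ) - 4 ≤ (corrLen δ : ℝ) := by
  have hX := (Xc_bounds δ).2
  have hT := (Tc_bounds δ).2
  have h1 : ((2 * Tc δ - 2 * Xc δ : ℤ) : ℝ) ≤ (corrLen δ : ℝ) := by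
    have : 2 * Tc δ - 2 * Xc δ ≤ ((corrLen δ : ℕ) : ℤ) := by unfold corrLen; omega
    exact_mod_cast this
  push_cast at h1
  have e : 3 / (4 * δ) = 3 / 2 * (1 / (2 * δ)) := by field_simp; ring
  rw [e] at hT
  linarith

end CorridorEnd

/-- **The corridor factor tends to zero**: `x_c^{2T-2X} → 0` as `δ → 0⁺`. [folklore] -/
theorem tendsto_pow_corrLen :
    Tendsto (fun δ : ℝ => hexCriticalFugacity ^ corrLen δ) (𝓝[>] 0) (𝓝 0) := by
  have hx := hexCriticalFugacity_pos_lt_one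
  refine (tendsto_pow_atTop_nhds_zero_of_lt_one hx.1.le hx.2).comp ?_
  rw [tendsto_atTop]
  intro N
  have hN : (0 : ℝ) < 1 / (2 * ((N : ℝ) + 4)) := by positivity
  filter_upwards [eventually_small hN] with δ hδ
  obtain ⟨hδ, -, hδN⟩ := hδ
  have h := le_corrLen hδ
  have h2 : (N : ℝ) + 4 ≤ 1 / (2 * δ) := by
    rw [le_div_iff₀ (by positivity)]
    calc ((N : ℝ) + 4) * (2 * δ) ≤ ((N : ℝ) + 4) * (2 * (1 / (2 * ((N : ℝ) + 4)))) := by gcongr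
      _ = 1 := by field_simp
  exact_mod_cast (by linarith : (N : ℝ) ≤ corrLen δ)

end Summit.CriticalPhenomena.SAWScalingLimit.Theorems.BoundaryClosureR.Negative
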